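import Mathlib

/-!
# Crux `ClassTransfer` (stmt-ValiantsHypothesis-7287), negative side — tools:
# "all cycles even" as freedom from odd-power fixed points, and the parity of its count

Lead prover of line `registered` (= `Cruxes/ClassTransfer/Lines/birth.lean`).  The third family
named in the crux's "why it might fail" is the EVEN-CYCLE DETERMINANT
`D^even_n = Σ_{σ ∈ S_n, all cycles even} sgn(σ) x^σ`.  A permutation of a finite set has all its
cycles of even length iff no ODD POWER of it fixes a point (`x` on a cycle of length `ℓ` is fixed
by `σ^t` iff `ℓ ∣ t`); this power-only form `∀ x j, (σ ^ (2j+1)) x ≠ x` is the one used in tree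
(no cycle-type bookkeeping).  This file (pure Mathlib, no definitions):

* `oddPowFree_conj_iff`, `oddPowFree_permCongr_iff`, `oddPowFree_sumCongr_iff`,
  `oddPowFree_fin_two_iff` — invariance under conjugation / transport, block-diagonal maps, and
  the two-point case (only the swap qualifies);
* `card_oddPowFree_step` — going up by two points, conjugation by the swap of the two fresh
  points is an involution on odd-power-free permutations whose fixed points are exactly the
  extensions `swap ⊕ δ'` (`Equiv.Perm.card_compl_support_modEq` at `p = 2`), so the counts on
  `n + 2` and on `n` points agree mod `2`; with `card_oddPowFree_zero` this gives
  `odd_card_oddPowFree`: **the number of all-cycles-even permutations of `2k` points is odd**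
  (it is `((2k-1)!!)²`);
* `sum_sign_mul_indicator_oddPowFree_ne_zero` — hence the SIGNED count
  `E_{2k} = Σ_{δ ∈ S_{2k}, all cycles even} sgn δ` (`= -(2k-1)!!(2k-3)!!`, EGF `√(1 - z²)`) is odd,
  in particular nonzero in `ℂ` — the constant met by the three-block reduction of
  `Negative/EvenCycleDetPerHard.lean`.

[folklore]
-/

set_option linter.dupNamespace false

noncomputable section

namespace Summit.ValiantsHypothesis.ValiantsHypothesis.Theorems.ClassTransfer.Negative

open Equiv Finset

/-- Freedom from odd-power fixed points is a conjugation invariant. [folklore] -/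
theorem oddPowFree_conj_iff {α : Type*} (c δ : Perm α) :
    (∀ (x : α) (j : ℕ), ((c * δ * c⁻¹) ^ (2 * j + 1)) x ≠ x) ↔
      ∀ (x : α) (j : ℕ), (δ ^ (2 * j + 1)) x ≠ x := by
  constructor
  · intro h x j hx
    apply h (c x) j
    rw [conj_pow, Perm.mul_apply, Perm.mul_apply]
    have : c⁻¹ (c x) = x := by simp
    rw [this, hx]
  · intro h x j hx
    apply h (c⁻¹ x) j
    rw [conj_pow, Perm.mul_apply, Perm.mul_apply] at hx
    have := congrArg (fun y => c⁻¹ y) hx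
    simpa using this

/-- Freedom from odd-power fixed points is invariant under transport of structure. [folklore] -/
theorem oddPowFree_permCongr_iff {α β : Type*} (e : α ≃ β) (δ : Perm α) :
    (∀ (x : β) (j : ℕ), ((e.permCongr δ) ^ (2 * j + 1)) x ≠ x) ↔
      ∀ (x : α) (j : ℕ), (δ ^ (2 * j + 1)) x ≠ x := by
  have hpow : ∀ t : ℕ, (e.permCongr δ) ^ t = e.permCongr (δ ^ t) := fun t =>
    (map_pow e.permCongrHom δ t).symm
  constructor
  · intro h x j hx
    apply h (e x) j
    rw [hpow, Equiv.permCongr_apply, Equiv.symm_apply_apply, hx]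
  · intro h x j hx
    apply h (e.symm x) j
    rw [hpow, Equiv.permCongr_apply] at hx
    simpa using congrArg e.symm hx

/-- Freedom from odd-power fixed points of a block-diagonal permutation. [folklore] -/
theorem oddPowFree_sumCongr_iff {α β : Type*} (ρ₁ : Perm α) (ρ₂ : Perm β) :
    (∀ (x : α ⊕ β) (j : ℕ), ((Equiv.sumCongr ρ₁ ρ₂) ^ (2 * j + 1)) x ≠ x) ↔
      (∀ (x : α) (j : ℕ), (ρ₁ ^ (2 * j + 1)) x ≠ x) ∧
        ∀ (x : β) (j : ℕ), (ρ₂ ^ (2 * j + 1)) x ≠ x := by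
  have hpow : ∀ t : ℕ, (Equiv.sumCongr ρ₁ ρ₂) ^ t = Equiv.sumCongr (ρ₁ ^ t) (ρ₂ ^ t) := fun t => by
    have := (map_pow (Perm.sumCongrHom α β) (ρ₁, ρ₂) t).symm
    simpa [Perm.sumCongrHom_apply] using this
  simp only [hpow]
  constructor
  · intro h
    exact ⟨fun x j hx => h (Sum.inl x) j (by simp [hx]), fun x j hx => h (Sum.inr x) j (by simp [hx])⟩
  · rintro ⟨h₁, h₂⟩ x j hx
    rcases x with a | b
    · exact h₁ a j (by simpa using hx)
    · exact h₂ b j (by simpa using hx)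

/-- On `Fin 2` the only permutation without odd-power fixed points is the swap. [folklore] -/
theorem oddPowFree_fin_two_iff (ρ : Perm (Fin 2)) :
    (∀ (x : Fin 2) (j : ℕ), (ρ ^ (2 * j + 1)) x ≠ x) ↔ ρ = Equiv.swap 0 1 := by
  have hsq : ∀ σ : Perm (Fin 2), σ ^ 2 = 1 := by decide
  have hodd : ∀ (σ : Perm (Fin 2)) (j : ℕ), σ ^ (2 * j + 1) = σ := by
    intro σ j
    rw [pow_succ, pow_mul, hsq, one_pow, one_mul]
  simp only [hodd]
  constructor
  · intro h
    have h0 : ρ 0 ≠ 0 := h 0 0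
    have h1 : ρ 1 ≠ 1 := h 1 0
    ext x
    fin_cases x
    · have : ρ 0 = 1 := by
        rcases Fin.exists_fin_two.1 ⟨ρ 0, rfl⟩ with h' | h'
        · exact absurd h' h0
        · exact h'
      simp [this]
    · have : ρ 1 = 0 := by
        rcases Fin.exists_fin_two.1 ⟨ρ 1, rfl⟩ with h' | h'
        · exact h'
        · exact absurd h' h1
      simp [this]
  · rintro rfl x _
    fin_cases x <;> decide

open Classical in
/-- **Two more points.**  Conjugation by the swap of two fresh points is an involution on the
odd-power-free permutations of `Fin (n + 2)`; its fixed points are exactly the extensions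
`swap ⊕ δ'` of odd-power-free permutations `δ'` of `Fin n`; hence the counts agree mod `2`.
[folklore] -/
theorem card_oddPowFree_step (n : ℕ) :
    Fintype.card {δ : Perm (Fin (n + 2)) // ∀ (x : Fin (n + 2)) (j : ℕ), (δ ^ (2 * j + 1)) x ≠ x} ≡
      Fintype.card {δ : Perm (Fin n) // ∀ (x : Fin n) (j : ℕ), (δ ^ (2 * j + 1)) x ≠ x}
        [MOD 2] := by
  classical
  set e : Fin 2 ⊕ Fin n ≃ Fin (n + 2) := finSumFinEquiv.trans (finCongr (Nat.add_comm 2 n))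
    with he
  set sw : Perm (Fin 2) := Equiv.swap 0 1 with hsw
  set τ : Perm (Fin (n + 2)) := e.permCongr (Equiv.sumCongr sw (1 : Perm (Fin n))) with hτ
  have hswP : ∀ (x : Fin 2) (j : ℕ), (sw ^ (2 * j + 1)) x ≠ x := (oddPowFree_fin_two_iff sw).2 hsw
  have hsw2 : sw * sw = 1 := by rw [hsw]; exact Equiv.swap_mul_self 0 1
  have hτ2 : τ * τ = 1 := by
    rw [hτ, ← Equiv.permCongr_mul, Perm.sumCongr_mul, hsw2, mul_one, Perm.sumCongr_one]
    exact map_one e.permCongrHom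
  have hτinv : τ⁻¹ = τ := by
    rw [eq_comm, ← mul_eq_one_iff_eq_inv]; exact hτ2
  -- the involution on the odd-power-free permutations of `Fin (n + 2)`
  set f : Perm {δ : Perm (Fin (n + 2)) // ∀ (x : Fin (n + 2)) (j : ℕ), (δ ^ (2 * j + 1)) x ≠ x} :=
    Equiv.subtypeEquiv (MulAut.conj τ).toEquiv
      (fun δ => ((oddPowFree_conj_iff τ δ).symm : _ ↔ ∀ x j, ((τ * δ * τ⁻¹) ^ (2 * j + 1)) x ≠ x))
    with hf
  have hfval : ∀ a, ((f a : {δ : Perm (Fin (n + 2)) // _}) : Perm (Fin (n + 2))) =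
      τ * (a : Perm (Fin (n + 2))) * τ⁻¹ := fun a => rfl
  have hf2 : f ^ 2 ^ 1 = 1 := by
    rw [pow_one, pow_two]
    refine Equiv.ext fun a => Subtype.ext ?_
    rw [Perm.mul_apply, hfval, hfval, Perm.one_apply, hτinv]
    rw [show τ * (τ * (a : Perm (Fin (n + 2))) * τ) * τ =
      (τ * τ) * (a : Perm (Fin (n + 2))) * (τ * τ) by group, hτ2, one_mul, mul_one]
  have hmod := Equiv.Perm.card_compl_support_modEq hf2
  -- fixed points of `f` = extensions of odd-power-free permutations of `Fin n`
  have hfix : f.supportᶜ.card =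
      Fintype.card {δ : Perm (Fin n) // ∀ (x : Fin n) (j : ℕ), (δ ^ (2 * j + 1)) x ≠ x} := by
    have h1 : f.supportᶜ = univ.filter fun a => f a = a := by
      ext a; simp [Perm.mem_support]
    rw [h1, ← Fintype.card_subtype]
    symm
    -- the extension map
    refine Fintype.card_of_bijective (f := fun δ' => ⟨⟨e.permCongr (Equiv.sumCongr sw δ'.1),
      (oddPowFree_permCongr_iff e _).2 ((oddPowFree_sumCongr_iff sw δ'.1).2 ⟨hswP, δ'.2⟩)⟩,
        ?_⟩) ⟨?_, ?_⟩
    · -- it lands in the fixed points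
      refine Subtype.ext ?_
      rw [hfval]
      show τ * e.permCongr (Equiv.sumCongr sw δ'.1) * τ⁻¹ = e.permCongr (Equiv.sumCongr sw δ'.1)
      rw [hτinv, hτ, ← Equiv.permCongr_mul, ← Equiv.permCongr_mul, Perm.sumCongr_mul,
        Perm.sumCongr_mul, hsw2, one_mul, mul_one, one_mul]
    · -- injective
      intro δ₁ δ₂ h
      have h' := congrArg (fun a => ((a.1 : {δ : Perm (Fin (n + 2)) // _}) : Perm (Fin (n + 2)))) h
      simp only at h'
      have h'' : Equiv.sumCongr sw δ₁.1 = Equiv.sumCongr sw δ₂.1 := e.permCongr.injective h'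
      refine Subtype.ext (Equiv.ext fun x => ?_)
      have := Equiv.congr_fun h'' (Sum.inr x)
      simpa using this
    · -- surjective
      rintro ⟨⟨δ, hP⟩, hfixed⟩
      have hcomm : τ * δ * τ⁻¹ = δ := by
        have := congrArg (fun a => ((a : {δ : Perm (Fin (n + 2)) // _}) : Perm (Fin (n + 2)))) hfixed
        simpa [hfval] using this
      set ρ : Perm (Fin 2 ⊕ Fin n) := e.symm.permCongr δ with hρ
      have hδρ : δ = e.permCongr ρ := by
        rw [hρ]; ext x; simp
      have hcomm' : Equiv.sumCongr sw (1 : Perm (Fin n)) * ρ = ρ * Equiv.sumCongr sw 1 := by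
        have h1 : τ * δ = δ * τ := by
          calc τ * δ = τ * δ * τ⁻¹ * τ := by group
            _ = δ * τ := by rw [hcomm]
        rw [hδρ, hτ, ← Equiv.permCongr_mul, ← Equiv.permCongr_mul] at h1
        exact e.permCongr.injective h1
      have hmaps : Set.MapsTo ρ (Set.range Sum.inl) (Set.range Sum.inl) := by
        rintro _ ⟨a, rfl⟩
        rcases hx : ρ (Sum.inl a) with a' | b
        · exact ⟨a', rfl⟩
        · exfalso
          have h1 := Equiv.congr_fun hcomm' (Sum.inl a)
          simp only [Perm.mul_apply, Equiv.sumCongr_apply, Sum.map_inl, hx, Sum.map_inr,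
            Perm.one_apply] at h1
          -- `ρ (inl (sw a)) = inr b = ρ (inl a)` forces `sw a = a`
          have h2 : Sum.inl (sw a) = (Sum.inl a : Fin 2 ⊕ Fin n) := ρ.injective (h1.symm.trans hx.symm)
          have h3 : sw a = a := Sum.inl_injective h2
          exact hswP a 0 (by simpa using h3)
      obtain ⟨⟨ρ₁, ρ₂⟩, hρ12⟩ := Perm.mem_sumCongrHom_range_of_perm_mapsTo_inl hmaps
      rw [Perm.sumCongrHom_apply] at hρ12
      simp only at hρ12
      have hPρ : ∀ (x : Fin 2 ⊕ Fin n) (j : ℕ), (ρ ^ (2 * j + 1)) x ≠ x := by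
        rw [hδρ] at hP
        exact (oddPowFree_permCongr_iff e ρ).1 hP
      rw [← hρ12] at hPρ
      obtain ⟨hP1, hP2⟩ := (oddPowFree_sumCongr_iff ρ₁ ρ₂).1 hPρ
      have hρ1 : ρ₁ = sw := (oddPowFree_fin_two_iff ρ₁).1 hP1
      refine ⟨⟨ρ₂, hP2⟩, Subtype.ext (Subtype.ext ?_)⟩
      show e.permCongr (Equiv.sumCongr sw ρ₂) = δ
      rw [hδρ, ← hρ12, hρ1]
  rw [hfix] at hmod
  exact hmod.symm

open Classical in
/-- No points: the unique permutation of `Fin 0` is (vacuously) odd-power-free. [folklore] -/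
theorem card_oddPowFree_zero :
    Fintype.card {δ : Perm (Fin 0) // ∀ (x : Fin 0) (j : ℕ), (δ ^ (2 * j + 1)) x ≠ x} = 1 := by
  classical
  rw [Fintype.card_subtype]
  have : (univ.filter fun δ : Perm (Fin 0) => ∀ (x : Fin 0) (j : ℕ), (δ ^ (2 * j + 1)) x ≠ x) =
      univ := by
    ext δ; simp
  rw [this, Finset.card_univ, Fintype.card_perm, Fintype.card_fin, Nat.factorial_zero]

open Classical in
/-- **The number of odd-power-free (= all-cycles-even) permutations of `2k` points is odd**
(it is `((2k-1)!!)²`). [folklore] -/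
theorem odd_card_oddPowFree (k : ℕ) :
    Odd (Fintype.card
      {δ : Perm (Fin (2 * k)) // ∀ (x : Fin (2 * k)) (j : ℕ), (δ ^ (2 * j + 1)) x ≠ x}) := by
  induction k with
  | zero => rw [Nat.mul_zero, card_oddPowFree_zero]; exact odd_one
  | succ k ih =>
    rw [Nat.mul_succ]
    have h := card_oddPowFree_step (2 * k)
    rw [Nat.odd_iff] at ih ⊢
    rw [Nat.ModEq] at h
    omega

open Classical in
/-- **The signed count of all-cycles-even permutations of `2k` points is nonzero** (it is odd;
in fact `-(2k-1)!!(2k-3)!!`): `Σ_{δ ∈ S_{2k}} sgn(δ) [δ odd-power-free] ≠ 0` in `ℂ`. [folklore] -/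
theorem sum_sign_mul_indicator_oddPowFree_ne_zero (k : ℕ) :
    ∑ δ : Perm (Fin (2 * k)), ((Perm.sign δ : ℤ) : ℂ) *
      (if (∀ (x : Fin (2 * k)) (j : ℕ), (δ ^ (2 * j + 1)) x ≠ x) then (1 : ℂ) else 0) ≠ 0 := by
  classical
  -- the integer version is odd
  set E : ℤ := ∑ δ : Perm (Fin (2 * k)), (Perm.sign δ : ℤ) *
    (if (∀ (x : Fin (2 * k)) (j : ℕ), (δ ^ (2 * j + 1)) x ≠ x) then (1 : ℤ) else 0) with hE
  have hcast : ∑ δ : Perm (Fin (2 * k)), ((Perm.sign δ : ℤ) : ℂ) *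
      (if (∀ (x : Fin (2 * k)) (j : ℕ), (δ ^ (2 * j + 1)) x ≠ x) then (1 : ℂ) else 0) = (E : ℂ) := by
    rw [hE]; push_cast
    refine Finset.sum_congr rfl fun δ _ => ?_
    split_ifs <;> simp
  rw [hcast, Int.cast_ne_zero]
  intro hE0
  have h2 : ((E : ℤ) : ZMod 2) = (Fintype.card
      {δ : Perm (Fin (2 * k)) // ∀ (x : Fin (2 * k)) (j : ℕ), (δ ^ (2 * j + 1)) x ≠ x} : ZMod 2) := by
    rw [hE, Fintype.card_subtype]
    push_cast
    rw [← Finset.sum_boole]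
    refine Finset.sum_congr rfl fun δ _ => ?_
    have hs : ((Perm.sign δ : ℤ) : ZMod 2) = 1 := by
      rcases Int.units_eq_one_or (Perm.sign δ) with h1 | h1 <;> rw [h1] <;> decide
    rw [hs, one_mul]
  rw [hE0, Int.cast_zero] at h2
  have h3 := (ZMod.natCast_eq_zero_iff_even.1 h2.symm)
  exact (Nat.not_even_iff_odd.2 (odd_card_oddPowFree k)) h3

end Summit.ValiantsHypothesis.ValiantsHypothesis.Theorems.ClassTransfer.Negative
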